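import Literature.AnabelianGeometry.EtaleTheta.Discharge.Sec3Prop34CnstOfRlfZ
import Literature.AnabelianGeometry.EtaleTheta.RealifiedDivisorMonoidsOfRlfR
import Literature.AlgebraicGeometry.Frobenioids.RlfStructure
import HarnessLib

/-!
# [EtTh] Prop 3.4 (ii) relative to `D^cnst` for the Def. 3.6 (i) data of monoid type `ℝ`
# (`RealifiedDivisorMonoids.ofRlfR`): what transports from the `B₀`-level, and what does not

Proof-only companion (theorems only, no definitions) of `TemperedFrobenioidCnst.lean` (abc-iut-L2-t3) in the
series `Discharge/Sec3*.lean`; sequel to `Discharge/Sec3Prop34CnstOfRlfZ.lean` (the monoid type `ℤ`).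
S. Mochizuki, *The étale theta function …*, Publ. RIMS **45** (2009) [EtTh], §3, Proposition 3.4 (ii) p.74,
Definition 3.6 (i) p.76, Theorem 3.7 (iii) pp.79–80 (PDF) of `paper:doi-10-2977-prims-1234361159`
[cite: MochizukiEtTh2009, Prop 3.4 (ii) p.74]:

> "`B₀^Λ` for `B₀` (resp. `B₀^pf`; `ℝ·Φ₀^birat`) if `Λ = ℤ` (resp. `ℚ`; `ℝ`), `F₀^Λ ⊆ B₀^Λ` for `F₀`
> (resp. `F₀^pf`; `ℝ·Φ₀^cnst`)" (Def. 3.6 (i)); "(iii) … the natural action of `Aut_C(A)` on `O^▷(A)`, `O^×(A)`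
> factors through `Aut_{D^cnst}(A^cnst)`. If, moreover, `Λ ∈ {ℤ, ℚ}`, then this factorization determines a
> faithful action …" (Thm. 3.7 (iii)).

Cell abc-iut, sub-DAG `plan/L2/SUBDAG-EtTh-Thm37.md` row «EtTh:Thm3.7(iii)/L10-R» (the `Λ = ℝ` transport
`Prop34 ∧ Prop34Cnst₀ ⇒ Prop34Cnst (ofRlfR dm hpf)` asked for by abc-iut-w5-d164, 2026-08-26T03:27:19Z).
RESULT.  Of the four clauses of `RealifiedDivisorMonoids.Prop34Cnst (ofRlfR dm hpf) cnst`: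
* clauses 2–3 (NATURALITY: the pull-back action on the constants `F₀^ℝ = ℝ·Φ₀^cnst` and on the log-divisors
  of constants factors through `cnst : D₀ → D^cnst`) FOLLOW from the single `B₀`-level naturality clause
  `Prop34Cnst₀.B₀_map_eq_of_cnst_map_eq`, by `ℝ`-linearity of the pull-backs of `(Φ₀^rlf)^gp`
  (`RealificationData.pullGp_rsmul`) and naturality of `B₀ → Φ₀^gp → (Φ₀^rlf)^gp`
  (`pullGp_eq_of_mem_realSpan_cnstGp`, `ofRlfR_BΛ_map_eq`, `ofRlfR_ΦR_map_eq`);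
* clause 4 (faithfulness for `Λ ∈ {ℤ, ℚ}`) is VACUOUS at `Λ = ℝ` (`ofRlfR_cnst_map_eq`);
* clause 1 — "an element of `B₀^ℝ(Y) = ℝ·Φ₀^birat(Y)` with EFFECTIVE image in `(Φ₀^ℝ)^gp(Y)` lies in
  `F₀^ℝ(Y) = ℝ·Φ₀^cnst(Y)`" — is NOT a formal consequence of the `B₀`-level Prop. 3.4 (ii)
  (`DivisorMonoids.Prop34`: effective locus of `B₀ ⊆ F₀`) and `Prop34Cnst₀`: a kernel counterexample over
  abstract perf-factorial data is `Discharge/Sec3Prop34CnstOfRlfRNegative.lean`.  Here it enters BY NAME as the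
  hypothesis `hE` of `Prop34Cnst.ofRlfR_of_eff`, stated at the `B₀^ℝ`-level in the tree's vocabulary, and
  `eff_of_prop34Cnst_ofRlfR` shows it is EXACTLY the residual (the two are equivalent given `Prop34Cnst₀`).
* `TemperedFrobenioid.thm37_iii_withCnst_ofRlfR` — hence Theorem 3.7 (iii), as typed, for every tempered
  Frobenioid over the constructed `Λ = ℝ` data, modulo `Prop34Cnst₀` and `hE`.
HONEST FRAMING: refereed pre-IUT material ([EtTh] 2009); nothing here bears on [IUTchIII] Cor. 3.12; no statement
of the paper is strengthened; typed ≠ proved — clause 1 for `Λ = ℝ` stays a named hypothesis.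
-/

noncomputable section

namespace Literature.AnabelianGeometry.EtaleTheta

open CategoryTheory Opposite Literature.AlgebraicGeometry.Frobenioids

universe u₀ v₀ u₁ v₁ u v w

namespace RealifiedDivisorMonoids.Prop34Cnst

variable {D₀ : Type u} [Category.{v} D₀] {dm : DivisorMonoids.{u, v, w} D₀}
  {hpf : ∀ Y : D₀ᵒᵖ, IsPerfFactorial (dm.Φ₀.obj Y)}
  {Dcnst : Type u₁} [Category.{v₁} Dcnst] {cnst : D₀ ⥤ Dcnst}

/-! ### The `B₀`-level naturality clause transports to `ℝ·Φ₀^cnst` -/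

/-- Morphisms `g, g' : Y → Y'` of `D₀` with the same image in `D^cnst` pull back every element of
`Φ₀^cnst(Y')` (indeed of the subgroup of `Φ₀(Y')^gp` it generates) identically — naturality of `B₀ → Φ₀^gp`
and `Prop34Cnst₀.B₀_map_eq_of_cnst_map_eq`. [cite: MochizukiEtTh2009, Prop 3.4 (ii) p.74] -/
theorem pullGp_eq_of_mem_cnstGp (h₀ : dm.Prop34Cnst₀ cnst) {Y Y' : D₀} (g g' : Y ⟶ Y')
    (hg : cnst.map g = cnst.map g') {c : Algebra.GrothendieckGroup (dm.Φ₀.obj (op Y'))}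
    (hc : c ∈ dm.cnstGp.carrier Y') : pullGp dm.Φ₀ g c = pullGp dm.Φ₀ g' c := by
  suffices hle : dm.cnstGp.carrier Y' ≤ (pullGp dm.Φ₀ g).eqLocus (pullGp dm.Φ₀ g') from hle hc
  refine (Subgroup.closure_le _).mpr ?_
  rintro _ ⟨b, hb, rfl⟩
  change pullGp dm.Φ₀ g (dm.div₀ (op Y') b) = pullGp dm.Φ₀ g' (dm.div₀ (op Y') b)
  rw [pullGp, pullGp, ← gpMap_eq_monGpMap, ← gpMap_eq_monGpMap, ← dm.div₀_natural g.op b,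
    ← dm.div₀_natural g'.op b, h₀.B₀_map_eq_of_cnst_map_eq g g' hg b hb]

/-- … hence pull back every element of `ℝ·Φ₀^cnst(Y') ⊆ (Φ₀^rlf)^gp(Y')` identically: the generators
`r • ι(c)` go to `r • ι(g^* c)` (`ℝ`-linearity of the pull-backs, naturality of `ι : Φ₀^gp → (Φ₀^rlf)^gp`).
[cite: MochizukiEtTh2009, Prop 3.4 (ii) p.74] -/
theorem pullGp_eq_of_mem_realSpan_cnstGp (h₀ : dm.Prop34Cnst₀ cnst) {Y Y' : D₀} (g g' : Y ⟶ Y')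
    (hg : cnst.map g = cnst.map g')
    {x : Algebra.GrothendieckGroup ((realData dm hpf).rlf.obj (op Y'))}
    (hx : x ∈ ((realData dm hpf).realSpan dm.cnstGp).carrier Y') :
    pullGp (realData dm hpf).rlf g x = pullGp (realData dm hpf).rlf g' x := by
  suffices hle : ((realData dm hpf).realSpan dm.cnstGp).carrier Y' ≤
      (pullGp (realData dm hpf).rlf g).eqLocus (pullGp (realData dm hpf).rlf g') from hle hx
  refine (Subgroup.closure_le _).mpr ?_
  rintro _ ⟨r, c, hc, rfl⟩
  change pullGp (realData dm hpf).rlf g ((realData dm hpf).rsmul Y' r ((realData dm hpf).toRlfGp Y' c)) =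
    pullGp (realData dm hpf).rlf g' ((realData dm hpf).rsmul Y' r ((realData dm hpf).toRlfGp Y' c))
  rw [(realData dm hpf).pullGp_rsmul g, (realData dm hpf).pullGp_rsmul g',
    ← (realData dm hpf).toRlfGp_pullGp g, ← (realData dm hpf).toRlfGp_pullGp g',
    pullGp_eq_of_mem_cnstGp h₀ g g' hg hc]

/-! ### Clauses 2–4 of `Prop34Cnst (ofRlfR dm hpf)` -/

/-- **Clause 2 for `Λ = ℝ`**: the pull-back action of `D₀` on the constants `F₀^ℝ = ℝ·Φ₀^cnst ⊆ B₀^ℝ =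
ℝ·Φ₀^birat` factors through `cnst : D₀ → D^cnst`. [cite: MochizukiEtTh2009, Prop 3.4 (ii) p.74] -/
theorem ofRlfR_BΛ_map_eq (h₀ : dm.Prop34Cnst₀ cnst) {Y Y' : D₀} (g g' : Y ⟶ Y')
    (hg : cnst.map g = cnst.map g') (b : (ofRlfR dm hpf).BΛ.obj (op Y'))
    (hb : b ∈ (ofRlfR dm hpf).FΛ (op Y')) :
    ((ofRlfR dm hpf).BΛ.map g.op).hom b = ((ofRlfR dm hpf).BΛ.map g'.op).hom b :=
  Subtype.ext (pullGp_eq_of_mem_realSpan_cnstGp h₀ g g' hg hb)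

/-- **Clause 3 for `Λ = ℝ`**: so does the pull-back action of `D₀` on the elements of `Φ₀^ℝ(Y') = Φ₀(Y')^rlf`
which are (effective) log-divisors of elements of `F₀^ℝ(Y')` (`Φ₀(Y)^rlf` is integral).
[cite: MochizukiEtTh2009, Prop 3.4 (ii) p.74] -/
theorem ofRlfR_ΦR_map_eq (h₀ : dm.Prop34Cnst₀ cnst) {Y Y' : D₀} (g g' : Y ⟶ Y')
    (hg : cnst.map g = cnst.map g') (x : (ofRlfR dm hpf).ΦR.obj (op Y'))
    (hx : ∃ b ∈ (ofRlfR dm hpf).FΛ (op Y'),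
      (ofRlfR dm hpf).divΛ (op Y') b = Algebra.GrothendieckGroup.of x) :
    ((ofRlfR dm hpf).ΦR.map g.op).hom x = ((ofRlfR dm hpf).ΦR.map g'.op).hom x := by
  obtain ⟨b, hb, hbx⟩ := hx
  apply (IsPerfFactorial.Rlf.isIntegral (hpf (op Y))).injective_of
  have h := pullGp_eq_of_mem_realSpan_cnstGp h₀ g g' hg hb
  change MonGp.map ((ofRlfR dm hpf).ΦR.map g.op).hom ((ofRlfR dm hpf).divΛ (op Y') b) =
    MonGp.map ((ofRlfR dm hpf).ΦR.map g'.op).hom ((ofRlfR dm hpf).divΛ (op Y') b) at h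
  rw [hbx, MonGp.map_of, MonGp.map_of] at h
  exact h

/-- **Clause 4 is vacuous for `Λ = ℝ`** (the faithfulness clause concerns `Λ ∈ {ℤ, ℚ}` only, as in print:
"If, moreover, `Λ ∈ {ℤ, ℚ}` …", p.80). [cite: MochizukiEtTh2009, Thm 3.7 (iii) p.80] -/
theorem ofRlfR_cnst_map_eq (hΛ : (ofRlfR dm hpf).Λ = MonoidType.Z ∨ (ofRlfR dm hpf).Λ = MonoidType.Q)
    {Y : D₀} (g g' : Y ≅ Y) : cnst.map g.hom = cnst.map g'.hom := by
  rcases hΛ with h | h <;> exact absurd h (by rw [ofRlfR_Λ]; decide)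

/-! ### Clause 1 as the exact residual, and the assembly -/

/-- **`Prop34Cnst (ofRlfR dm hpf) cnst` from the `B₀`-level naturality clauses and the `Λ = ℝ` effective-locus
clause BY NAME** (`hE`: "an element of `ℝ·Φ₀^birat(Y)` whose image in `(Φ₀^rlf)^gp(Y)` is [the class of] an
element of `Φ₀(Y)^rlf` lies in `ℝ·Φ₀^cnst(Y)`" — the `Λ = ℝ` reading of Prop. 3.4 (ii), isomorphisms 1–2,
which is not a formal consequence of the `B₀`-level data: `Discharge/Sec3Prop34CnstOfRlfRNegative.lean`).
[cite: MochizukiEtTh2009, Prop 3.4 (ii) p.74] -/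
theorem ofRlfR_of_eff (h₀ : dm.Prop34Cnst₀ cnst)
    (hE : ∀ (Y : D₀) (b : Algebra.GrothendieckGroup ((realData dm hpf).rlf.obj (op Y))) (x : (hpf (op Y)).Rlf),
      b ∈ ((realData dm hpf).realSpan dm.biratGp).carrier Y → b = Algebra.GrothendieckGroup.of x →
        b ∈ ((realData dm hpf).realSpan dm.cnstGp).carrier Y) :
    (ofRlfR dm hpf).Prop34Cnst cnst where
  mem_FΛ_of_divΛ_eq_of Y b x hbx := hE (unop Y) b.1 x b.2 hbx
  BΛ_map_eq_of_cnst_map_eq g g' hg b hb := ofRlfR_BΛ_map_eq h₀ g g' hg b hb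
  ΦR_map_eq_of_cnst_map_eq g g' hg x hx := ofRlfR_ΦR_map_eq h₀ g g' hg x hx
  cnst_map_eq_of_BΛ_map_eq hΛ _ g g' _ := ofRlfR_cnst_map_eq hΛ g g'

/-- Conversely clause 1 of `Prop34Cnst (ofRlfR dm hpf) cnst` IS the hypothesis `hE` (so `hE` is exactly the
residual of the row, neither weaker nor stronger). [cite: MochizukiEtTh2009, Prop 3.4 (ii) p.74] -/
theorem eff_of_prop34Cnst_ofRlfR (h : (ofRlfR dm hpf).Prop34Cnst cnst) (Y : D₀)
    (b : Algebra.GrothendieckGroup ((realData dm hpf).rlf.obj (op Y))) (x : (hpf (op Y)).Rlf)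
    (hb : b ∈ ((realData dm hpf).realSpan dm.biratGp).carrier Y) (hbx : b = Algebra.GrothendieckGroup.of x) :
    b ∈ ((realData dm hpf).realSpan dm.cnstGp).carrier Y :=
  h.mem_FΛ_of_divΛ_eq_of (op Y) ⟨b, hb⟩ x hbx

end RealifiedDivisorMonoids.Prop34Cnst

/-! ### Theorem 3.7 (iii) over the constructed `Λ = ℝ` data -/

namespace TemperedFrobenioid

variable {D₀ : Type u} [Category.{v} D₀] {dm : DivisorMonoids.{u, v, w} D₀}
  {hpf : ∀ Y : D₀ᵒᵖ, IsPerfFactorial (dm.Φ₀.obj Y)}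
  {D : Type u₀} [Category.{v₀} D] {VD : FrdICatStub.{u₀, v₀, w} D}
  (C₀ : TemperedFrobenioid (RealifiedDivisorMonoids.ofRlfR dm hpf) D VD)
  {Dcnst : Type u₁} [Category.{v₁} Dcnst] {cnst : D₀ ⥤ Dcnst}

/-- **Theorem 3.7 (iii) for a tempered Frobenioid of monoid type `ℝ` over the CONSTRUCTED Def. 3.6 (i) data
`ofRlfR dm hpf`**, at the instantiated facade, modulo the `B₀`-level naturality clauses `dm.Prop34Cnst₀ cnst`
and the `Λ = ℝ` effective-locus clause `hE` BY NAME. [cite: MochizukiEtTh2009, Thm 3.7 (iii) p.79] -/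
theorem thm37_iii_withCnst_ofRlfR (F : FrobenioidFacade.{u₀, v₀, w} D) (h₀ : dm.Prop34Cnst₀ cnst)
    (hE : ∀ (Y : D₀) (b : Algebra.GrothendieckGroup ((RealifiedDivisorMonoids.realData dm hpf).rlf.obj (op Y)))
      (x : (hpf (op Y)).Rlf),
      b ∈ ((RealifiedDivisorMonoids.realData dm hpf).realSpan dm.biratGp).carrier Y →
        b = Algebra.GrothendieckGroup.of x →
        b ∈ ((RealifiedDivisorMonoids.realData dm hpf).realSpan dm.cnstGp).carrier Y) :
    C₀.Thm37_iii (F.withCnst (C₀.base ⋙ cnst)) :=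
  C₀.thm37_iii_withCnst F (RealifiedDivisorMonoids.Prop34Cnst.ofRlfR_of_eff h₀ hE)

end TemperedFrobenioid

end Literature.AnabelianGeometry.EtaleTheta

end
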